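import Summits.AnomalousDissipation.AnomalousDissipation.Theorems.ImpulseGridGridInjectionIdentity
import Literature.Analysis.FluidPDE.LerayHopfMomentum

/-!
# Route ImpulseGrid (AnomalousDissipation) — no reversal of a sub-threshold wake

Stub `stub_noReversalOfSubthresholdWake` of the line `Sketch` of the crux
`Summit.AnomalousDissipation.AnomalousDissipation.Theses.ImpulseGrid.GridThesis`
(item `stmt-AnomalousDissipation-1770`): the barrier lemma behind clause (a) NO REVERSAL. For the
slab⊗transverse force `Φ•G` (`G` smooth, `x₀`-invariant, `G₀ ≡ 0`, divergence free, a Stokes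
eigenfield `ΔG = -λG`, with the strain bound `|⟪ξ,(ξ·∇)G⟫| ≤ σ‖ξ‖²`), a global Leray–Hopf solution
`u` with datum `u₀`, `∫u₀ = c e₀`, aligned initial imprint `(G,u₀) ≥ 0`, and the sub-threshold
energy condition `σ(2·KE(u(t)) − c²) ≤ (Φ•G, G)` whenever `(G,u(t)) ≤ 0`, the imprint
`a(t) = (G, u(t))` never becomes negative (`t > 0`).

Proof. By the time-sliced weak formulation (`Torus.IsLerayHopfOn.integral_inner_sub_eq_setIntegral`,
Temam 1984 Ch. III (1.25)) `a(t) − a(s) = ∫ₛᵗ flux`, `flux = T_G + ν(u,ΔG) + (Φ•G,G)`,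
`T_G = ∫⟪u,(u·∇)G⟫`. EXACT PRODUCTION BOUND: with `w = u − m e₀`, `m = ∫ ⟪u₀, e₀⟫` the conserved
momentum (`Torus.IsLerayHopfOn.integral_inner_const_eq` with a mean-zero force),
`∫⟪u,(u·∇)G⟫ = ∫⟪w,(w·∇)G⟫` (`∂₀G = 0`, `G₀ ≡ 0`; `GridInjection.integral_inner_convect_eq_shift`),
so the strain bound gives `T_G ≥ −σ∫‖w‖² = −σ(∫‖u‖² − m²) ≥ −σ(2·KE(u) − c²)` (`m = c` if `u₀` is
integrable, else `c = 0`). Hence `flux ≥ −νλ a ≥ 0` while `a ≤ 0`, and the abstract barrier lemma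
`NoReversal.nonneg_of_barrier` (continuity of `a` on `[0,∞)` from the weak `L²`-continuity clause,
`a(0) := (G,u₀) ≥ 0`) concludes. The hypotheses on the pressure `q` of the steady Euler state and
the sup-energy bound are not needed.

References: R. Temam, *Navier–Stokes Equations* (1984), Ch. III §1.1 (1.25); C. Foias, O. Manley,
R. Rosa, R. Temam, *Navier–Stokes Equations and Turbulence* (2001), Ch. II App. A, Ch. IV §3.1.
-/

noncomputable section

-- `Summit.<Summit>.<Problem>` is the tree's mandated summit-side namespace (CONVENTIONS §2); for
-- this single-conjunct summit the two coincide, so the duplicate is deliberate.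
set_option linter.dupNamespace false

open MeasureTheory Set Filter Topology
open scoped InnerProductSpace RealInnerProductSpace

namespace Summit.AnomalousDissipation.AnomalousDissipation.Theorems

open Literature.Analysis.FluidPDE Literature.Analysis.FluidPDE.Torus
open Literature.Analysis.FunctionSpaces Literature.Analysis.FunctionSpaces.Torus

namespace NoReversal

/-! ### The abstract barrier lemma -/

-- adapted from Cruxes/GridThesis/SketchIdeator2.lean (`nonneg_of_barrier`, crux-ideate round 1)
/-- **Abstract barrier lemma.** A continuous `a : ℝ → ℝ` with `a 0 ≥ 0` which is non-decreasing on
every interval of `[0,∞)` on which it is negative (`a < 0` on `[s,t]` ⇒ `a s ≤ a t`) stays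
non-negative on `[0,∞)`. [folklore] -/
theorem nonneg_of_barrier {a : ℝ → ℝ} (ha : Continuous a) (h0 : 0 ≤ a 0)
    (hmono : ∀ s t : ℝ, 0 ≤ s → s ≤ t → (∀ τ ∈ Icc s t, a τ < 0) → a s ≤ a t) :
    ∀ t : ℝ, 0 ≤ t → 0 ≤ a t := by
  intro t ht
  by_contra hneg
  push Not at hneg
  -- the set of good times before `t`
  set A : Set ℝ := {s | s ∈ Icc 0 t ∧ 0 ≤ a s} with hA
  have hA0 : (0 : ℝ) ∈ A := ⟨⟨le_rfl, ht⟩, h0⟩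
  have hAne : A.Nonempty := ⟨0, hA0⟩
  have hAbdd : BddAbove A := ⟨t, fun s hs => hs.1.2⟩
  set s₀ := sSup A with hs₀
  have hs₀_le : s₀ ≤ t := csSup_le hAne fun s hs => hs.1.2
  have hs₀_ge : 0 ≤ s₀ := le_csSup hAbdd hA0
  -- `A` is closed, so `s₀ ∈ A`
  have hAclosed : IsClosed A := by
    have : A = Icc 0 t ∩ a ⁻¹' Ici 0 := by
      ext s; simp [hA, Set.mem_Ici]
    rw [this]
    exact isClosed_Icc.inter (isClosed_Ici.preimage ha)
  have hs₀A : s₀ ∈ A := hAclosed.csSup_mem hAne hAbdd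
  have has₀ : 0 ≤ a s₀ := hs₀A.2
  -- `s₀ < t` since `a t < 0`
  have hs₀_lt : s₀ < t := lt_of_le_of_ne hs₀_le (fun h => by rw [h] at has₀; linarith)
  -- on `(s₀, t]` the function is negative
  have hneg' : ∀ τ, s₀ < τ → τ ≤ t → a τ < 0 := by
    intro τ h1 h2
    by_contra hτ
    push Not at hτ
    have hτA : τ ∈ A := ⟨⟨le_trans hs₀_ge h1.le, h2⟩, hτ⟩
    have : τ ≤ s₀ := le_csSup hAbdd hτA
    linarith
  -- on `[τ₁, t]`, `τ₁ ∈ (s₀, t]`, we have `a < 0`, so `a τ₁ ≤ a t < 0`; letting `τ₁ ↓ s₀`,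
  -- continuity gives `a s₀ ≤ a t < 0`, contradicting `0 ≤ a s₀`.
  have hlim : Tendsto a (nhdsWithin s₀ (Ioc s₀ t)) (nhds (a s₀)) :=
    (ha.tendsto s₀).mono_left nhdsWithin_le_nhds
  have hev : ∀ᶠ τ in nhdsWithin s₀ (Ioc s₀ t), a τ ≤ a t := by
    refine eventually_nhdsWithin_of_forall fun τ hτ => ?_
    exact hmono τ t (le_trans hs₀_ge hτ.1.le) hτ.2 fun σ hσ =>
      hneg' σ (lt_of_lt_of_le hτ.1 hσ.1) hσ.2
  have hne : (nhdsWithin s₀ (Ioc s₀ t)).NeBot := by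
    rw [← mem_closure_iff_nhdsWithin_neBot, closure_Ioc hs₀_lt.ne]
    exact ⟨le_rfl, hs₀_le⟩
  have : a s₀ ≤ a t := le_of_tendsto hlim hev
  linarith

variable {ν : ℝ} {f : ℝ → UnitAddTorus (Fin 3) → EuclideanSpace ℝ (Fin 3)}
  {F G U u₀ w : UnitAddTorus (Fin 3) → EuclideanSpace ℝ (Fin 3)}
  {u : ℝ → UnitAddTorus (Fin 3) → EuclideanSpace ℝ (Fin 3)}

/-! ### The continuous extension of a weak pairing by its initial value -/

/-- For a global Leray–Hopf solution and `w ∈ L²`, the pairing `t ↦ (u(t), w)` extended by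
`(u₀, w)` for `t ≤ 0` is continuous on `ℝ` (weak `L²`-continuity on every `(0, T]` and the weak
limit `u₀` at `0⁺`). [folklore] -/
theorem continuous_pairingExtension (hu : IsGlobalLerayHopf ν f u₀ u) (hw : MemLp w 2 volume) :
    Continuous fun t : ℝ => if 0 < t then ∫ x, ⟪u t x, w x⟫ else ∫ x, ⟪u₀ x, w x⟫ := by
  refine continuous_iff_continuousAt.2 fun t₀ => ?_
  rcases lt_trichotomy t₀ 0 with ht₀ | rfl | ht₀
  · -- `t₀ < 0`: eventually constant
    refine (continuousAt_const (y := ∫ x, ⟪u₀ x, w x⟫)).congr ?_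
    filter_upwards [Iio_mem_nhds ht₀] with t ht
    rw [if_neg (not_lt.2 (mem_Iio.1 ht).le)]
  · -- `t₀ = 0`: constant on the left, the weak limit `u₀` on the right
    have hlim := ((hu 1 one_pos).weak_continuous w hw).2
    have key : Tendsto (fun t : ℝ => if 0 < t then ∫ x, ⟪u t x, w x⟫ else ∫ x, ⟪u₀ x, w x⟫)
        (𝓝 0) (𝓝 (∫ x, ⟪u₀ x, w x⟫)) := by
      rw [← nhdsLE_sup_nhdsGT (0 : ℝ)]
      refine Tendsto.sup ?_ ?_
      · refine tendsto_const_nhds.congr' ?_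
        filter_upwards [self_mem_nhdsWithin] with t ht
        rw [if_neg (not_lt.2 (mem_Iic.1 ht))]
      · refine hlim.congr' ?_
        filter_upwards [self_mem_nhdsWithin] with t ht
        rw [if_pos (mem_Ioi.1 ht)]
    simpa only [ContinuousAt, lt_self_iff_false, if_false] using key
  · -- `t₀ > 0`: weak continuity on `(0, t₀ + 1]`
    have hc : ContinuousAt (fun t => ∫ x, ⟪u t x, w x⟫) t₀ :=
      ((hu (t₀ + 1) (by linarith)).weak_continuous w hw).1.continuousAt
        (Ioc_mem_nhds ht₀ (by linarith))
    refine hc.congr ?_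
    filter_upwards [Ioi_mem_nhds ht₀] with t ht
    rw [if_pos (mem_Ioi.1 ht)]

/-! ### Momentum bookkeeping -/

/-- **Momentum is conserved from the datum** under a steady smooth mean-zero force: for a global
Leray–Hopf solution, `∫ ⟪u(t), e⟫ = ∫ ⟪u₀, e⟫` for every constant vector `e` and `t > 0` (the
time-sliced weak formulation tested with the constant field `e`,
`Torus.IsLerayHopfOn.integral_inner_const_eq`, and `∫⟪F, e⟫ = ⟪∫F, e⟫ = 0`). [folklore] -/
theorem integral_inner_const_eq_datum (hFs : IsSmooth F) (hF0 : HasZeroMean F)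
    (hu : IsGlobalLerayHopf ν (fun _ => F) u₀ u) (e : EuclideanSpace ℝ (Fin 3)) {t : ℝ}
    (ht : 0 < t) : ∫ x, ⟪u t x, e⟫ = ∫ x, ⟪u₀ x, e⟫ := by
  rw [(hu t ht).integral_inner_const_eq ht (aestronglyMeasurable_stLift_const hFs _)
    (lintegral_enorm_sq_const_lt_top hFs t) e ⟨ht, le_rfl⟩]
  have h0 : ∫ x, ⟪F x, e⟫ = 0 := by
    have hflip : (∫ x, ⟪F x, e⟫) = ∫ x, ⟪e, F x⟫ :=
      integral_congr_ae (ae_of_all _ fun x => real_inner_comm _ _)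
    have hF0' : ∫ x, F x = 0 := hF0
    rw [hflip, integral_inner hFs.integrable e, hF0', inner_zero_right]
  simp [h0]

/-- The drift datum `∫ u₀ = c e₀` controls the conserved `e₀`-momentum `m = ∫ ⟪u₀, e₀⟫`:
`c² ≤ m²` (`m = c` when `u₀` is integrable; otherwise the Bochner integral `∫ u₀` vanishes and
`c = 0`). [folklore] -/
theorem sq_le_sq_of_integral_eq_smul {c : ℝ} (h : ∫ x, u₀ x = c • EuclideanSpace.single 0 1) :
    c ^ 2 ≤ (∫ x, ⟪u₀ x, EuclideanSpace.single 0 1⟫) ^ 2 := by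
  by_cases hint : Integrable u₀ volume
  · have h1 : (∫ x, ⟪u₀ x, EuclideanSpace.single 0 1⟫) = c := by
      have hflip : (∫ x, ⟪u₀ x, EuclideanSpace.single (0 : Fin 3) (1 : ℝ)⟫) =
          ∫ x, ⟪EuclideanSpace.single (0 : Fin 3) (1 : ℝ), u₀ x⟫ :=
        integral_congr_ae (ae_of_all _ fun x => real_inner_comm _ _)
      rw [hflip, integral_inner hint, h, real_inner_smul_right, EuclideanSpace.inner_single_left]
      simp
    rw [h1]
  · rw [integral_undef hint] at h
    have hc : (c • EuclideanSpace.single (0 : Fin 3) (1 : ℝ)) 0 = 0 := by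
      rw [← h]
      rfl
    have hc' : c = 0 := by simpa using hc
    rw [hc', sq, zero_mul]
    exact sq_nonneg _

/-! ### The exact production bound -/

/-- `∫ ‖U - v‖² = ∫ ‖U‖² - 2 ∫⟪U, v⟫ + ‖v‖²` for `U ∈ L²(T³)` and a constant vector `v`
(the torus has volume one). [folklore] -/
theorem integral_norm_sub_const_sq (hU : MemLp U 2 volume) (v : EuclideanSpace ℝ (Fin 3)) :
    ∫ x, ‖U x - v‖ ^ 2 = (∫ x, ‖U x‖ ^ 2) - 2 * (∫ x, ⟪U x, v⟫) + ‖v‖ ^ 2 := by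
  have h2 : Integrable (fun x => ‖U x‖ ^ 2) volume := hU.integrable_norm_pow two_ne_zero
  have h1 : Integrable (fun x => ⟪U x, v⟫) volume :=
    integrable_inner_of_continuous (hU.integrable one_le_two) continuous_const
  have h12 : Integrable (fun x => ‖U x‖ ^ 2 - 2 * ⟪U x, v⟫) volume := h2.sub (h1.const_mul 2)
  simp_rw [norm_sub_sq_real]
  rw [integral_add h12 (integrable_const _), integral_sub h2 (h1.const_mul 2),
    integral_const_mul, integral_const, probReal_univ, one_smul]

/-- **Exact production bound.** Let `G` be smooth with `G₀ ≡ 0`, `∂₀ G = 0` and the strain bound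
`|⟪ξ, (ξ·∇)G⟫| ≤ σ‖ξ‖²`, and let `U ∈ L²` with `e₀`-momentum `∫ ⟪U, e₀⟫ = m`. Then
`∫ ⟪U, (U·∇)G⟫ ≥ −σ (∫‖U‖² − m²)`: with `W = U − m e₀`, `∫⟪U,(U·∇)G⟫ = ∫⟪W,(W·∇)G⟫`
(`GridInjection.integral_inner_convect_eq_shift`), `⟪W,(W·∇)G⟫ ≥ −σ‖W‖²` pointwise, and
`∫‖W‖² = ∫‖U‖² − m²`. [folklore] -/
theorem neg_mul_le_integral_inner_convect (hG : IsSmooth G) (hG0 : ∀ y, G y 0 = 0)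
    (hdG : ∀ y, partialDeriv 0 G y = 0) {σ : ℝ}
    (hstrain : ∀ (x : UnitAddTorus (Fin 3)) (ξ : EuclideanSpace ℝ (Fin 3)),
      |⟪ξ, convect (fun _ => ξ) G x⟫| ≤ σ * ‖ξ‖ ^ 2)
    (hU : MemLp U 2 volume) {m : ℝ} (hm : ∫ x, ⟪U x, EuclideanSpace.single 0 1⟫ = m) :
    -(σ * ((∫ x, ‖U x‖ ^ 2) - m ^ 2)) ≤ ∫ x, ⟪U x, convect U G x⟫ := by
  set e : EuclideanSpace ℝ (Fin 3) := EuclideanSpace.single 0 1 with he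
  have hdG' : ∀ y, partialDeriv 0 G y = (fun _ => (0 : ℝ)) y • G y := fun y => by
    rw [zero_smul]
    exact hdG y
  have hWmem : MemLp (fun y => U y - m • e) 2 volume := hU.sub (memLp_const _)
  have i1 := integrable_inner_convect_self hWmem hG
  have i2 : Integrable (fun x => ‖U x - m • e‖ ^ 2) volume := hWmem.integrable_norm_pow two_ne_zero
  -- the `L²` norm of the shifted field
  have hnorm : ∫ x, ‖U x - m • e‖ ^ 2 = (∫ x, ‖U x‖ ^ 2) - m ^ 2 := by
    rw [integral_norm_sub_const_sq hU (m • e)]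
    have h1 : ∫ x, ⟪U x, m • e⟫ = m * m := by
      simp_rw [real_inner_smul_right]
      rw [integral_const_mul, hm]
    have h2 : ‖m • e‖ ^ 2 = m ^ 2 := by
      rw [← real_inner_self_eq_norm_sq, real_inner_smul_left, real_inner_smul_right, he,
        EuclideanSpace.inner_single_left]
      simp [sq]
    rw [h1, h2]
    ring
  -- the pointwise strain bound on the shifted field
  have hpt : ∀ x, -(σ * ‖U x - m • e‖ ^ 2) ≤ ⟪U x - m • e, convect (fun y => U y - m • e) G x⟫ :=
    fun x => (abs_le.1 (hstrain x (U x - m • e))).1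
  rw [GridInjection.integral_inner_convect_eq_shift hG hG.continuous continuous_const hG0 hG0 hdG'
    m hU]
  simp only [zero_mul, integral_zero, mul_zero, add_zero]
  calc -(σ * ((∫ x, ‖U x‖ ^ 2) - m ^ 2)) = ∫ x, -(σ * ‖U x - m • e‖ ^ 2) := by
        rw [integral_neg, integral_const_mul, hnorm]
    _ ≤ ∫ x, ⟪U x - m • e, convect (fun y => U y - m • e) G x⟫ :=
        integral_mono (i2.const_mul σ).neg i1 hpt

end NoReversal

/-- **Stub `stub_noReversalOfSubthresholdWake` (line `Sketch` of crux `GridThesis`,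
item stmt-AnomalousDissipation-1770): no reversal of a sub-threshold wake.** For the grid design
(`G` smooth, `x₀`-invariant, `G₀ ≡ 0`, divergence free, `ΔG = −λG`, strain bound `σ`) and a global
Leray–Hopf solution driven by the mean-zero force `Φ•G` with drift datum `∫u₀ = c e₀`, aligned
initial imprint `(G,u₀) ≥ 0` and the sub-threshold condition
`(G,u(t)) ≤ 0 ⇒ σ(2·KE(u(t)) − c²) ≤ (Φ•G, G)` (`t > 0`), the imprint `(G,u(t))` is `≥ 0` for all
`t > 0`: `a(t) − a(s) = ∫ₛᵗ (T_G − νλ a + (Φ•G,G))` (time-sliced weak formulation), the exact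
production bound `T_G ≥ −σ(2·KE − c²)` (`NoReversal.neg_mul_le_integral_inner_convect` with the
conserved momentum), so the flux is `≥ 0` while `a ≤ 0`, and the barrier lemma
`NoReversal.nonneg_of_barrier` applies to the continuous extension of `a` by `(G,u₀)` at `t ≤ 0`.
The steady-Euler hypotheses on `q` and the sup-energy bound are not used. [folklore] -/
theorem stub_noReversalOfSubthresholdWake :
    ∀ (ν lam σ c : ℝ) (Φ : UnitAddTorus (Fin 3) → ℝ)
      (G u₀ : UnitAddTorus (Fin 3) → EuclideanSpace ℝ (Fin 3)) (q : UnitAddTorus (Fin 3) → ℝ)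
      (u : ℝ → UnitAddTorus (Fin 3) → EuclideanSpace ℝ (Fin 3)),
      0 ≤ ν * lam → 0 ≤ σ →
      IsSmooth G → (∀ (s : UnitAddCircle) x, G (x + Pi.single (0 : Fin 3) s) = G x) →
      (∀ x, G x 0 = 0) → IsDivFree G → (∀ x, laplacian G x = -(lam • G x)) →
      IsSmooth q → (∀ (s : UnitAddCircle) x, q (x + Pi.single (0 : Fin 3) s) = q x) →
      (∀ x, convect G G x = gradient q x) →
      (∀ x (ξ : EuclideanSpace ℝ (Fin 3)), |⟪ξ, convect (fun _ => ξ) G x⟫| ≤ σ * ‖ξ‖ ^ 2) →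
      IsSmooth (fun x => Φ x • G x) → HasZeroMean (fun x => Φ x • G x) →
      IsGlobalLerayHopf ν (fun _ => fun x => Φ x • G x) u₀ u →
      (∃ C₀ : ℝ, ∀ t : ℝ, 0 ≤ t → kineticEnergy (u t) ≤ C₀) →
      (∫ x, u₀ x = c • EuclideanSpace.single 0 1) →
      (0 ≤ ∫ x, ⟪G x, u₀ x⟫) →
      (∀ t : ℝ, 0 < t → (∫ x, ⟪G x, u t x⟫) ≤ 0 →
        σ * (2 * kineticEnergy (u t) - c ^ 2) ≤ ∫ x, ⟪Φ x • G x, G x⟫) →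
      ∀ t : ℝ, 0 < t → 0 ≤ ∫ x, ⟪G x, u t x⟫ := by
  intro ν lam σ c Φ G u₀ q u hνl hσ hG hGinv hG0 hGdiv hΔG _hq _hqinv _hGG hstrain hfs hfmean hu
    _hsup hdrift hal hthr
  have hcomm : ∀ v : UnitAddTorus (Fin 3) → EuclideanSpace ℝ (Fin 3),
      (∫ x, ⟪G x, v x⟫) = ∫ x, ⟪v x, G x⟫ := fun v =>
    integral_congr_ae (ae_of_all _ fun x => real_inner_comm _ _)
  have hF : MemLp (fun x => Φ x • G x) 2 volume := hfs.memLp 2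
  have hdG : ∀ y, partialDeriv 0 G y = 0 :=
    GridInjection.partialDeriv_eq_zero_of_forall_add_single hGinv
  -- the conserved `e₀`-momentum `m`, `c² ≤ m²`
  have hmom : ∀ τ : ℝ, 0 < τ → ∫ x, ⟪u τ x, EuclideanSpace.single 0 1⟫ =
      ∫ x, ⟪u₀ x, EuclideanSpace.single 0 1⟫ := fun τ hτ =>
    NoReversal.integral_inner_const_eq_datum hfs hfmean hu _ hτ
  have hcm : c ^ 2 ≤ (∫ x, ⟪u₀ x, EuclideanSpace.single 0 1⟫) ^ 2 :=
    NoReversal.sq_le_sq_of_integral_eq_smul hdrift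
  -- the flux is non-negative while the imprint is non-positive
  have hflux : ∀ τ : ℝ, 0 < τ → (∫ x, ⟪u τ x, G x⟫) ≤ 0 →
      0 ≤ trajFlux ν (fun x => Φ x • G x) u G τ := by
    intro τ hτ ha
    rw [GridInjection.trajFlux_eq_of_nonneg hF hu hG hτ.le]
    have h1 := NoReversal.neg_mul_le_integral_inner_convect hG hG0 hdG hstrain (hu.memLp_two hτ.le)
      (hmom τ hτ)
    have h2 : ∫ x, ⟪u τ x, laplacian G x⟫ = -(lam * ∫ x, ⟪u τ x, G x⟫) := by
      rw [← integral_const_mul, ← integral_neg]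
      refine integral_congr_ae (ae_of_all _ fun x => ?_)
      show ⟪u τ x, laplacian G x⟫ = -(lam * ⟪u τ x, G x⟫)
      rw [hΔG x, inner_neg_right, real_inner_smul_right]
    have h3 := hthr τ hτ (by rw [hcomm (u τ)]; exact ha)
    have hKE : kineticEnergy (u τ) = 2⁻¹ * ∫ x, ‖u τ x‖ ^ 2 := rfl
    rw [hKE] at h3
    rw [h2]
    linarith [mul_nonneg hνl (neg_nonneg.2 ha), mul_le_mul_of_nonneg_left hcm hσ]
  -- increments of the imprint are integrals of the flux (time-sliced weak formulation)
  have hinc : ∀ s t : ℝ, 0 < s → s ≤ t →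
      (∫ x, ⟪u t x, G x⟫) - (∫ x, ⟪u s x, G x⟫) =
        ∫ τ in Ioc s t, trajFlux ν (fun x => Φ x • G x) u G τ :=
    fun s t hs hst => (hu t (hs.trans_le hst)).integral_inner_sub_eq_setIntegral (hs.trans_le hst)
      (aestronglyMeasurable_stLift_const hfs _) (lintegral_enorm_sq_const_lt_top hfs t) hG hGdiv hs
      hst le_rfl
  -- the continuous extension of the imprint by `(u₀, G)` at `t ≤ 0`
  obtain ⟨a, ha_cont, ha_pos, ha_zero⟩ : ∃ a : ℝ → ℝ, Continuous a ∧
      (∀ t, 0 < t → a t = ∫ x, ⟪u t x, G x⟫) ∧ a 0 = ∫ x, ⟪u₀ x, G x⟫ :=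
    ⟨fun t => if 0 < t then ∫ x, ⟪u t x, G x⟫ else ∫ x, ⟪u₀ x, G x⟫,
      NoReversal.continuous_pairingExtension hu (hG.memLp 2), fun t ht => if_pos ht,
      if_neg (lt_irrefl 0)⟩
  have ha0 : 0 ≤ a 0 := by
    rw [ha_zero, ← hcomm u₀]
    exact hal
  have hmono : ∀ s t : ℝ, 0 ≤ s → s ≤ t → (∀ τ ∈ Icc s t, a τ < 0) → a s ≤ a t := by
    intro s t hs hst hneg
    have hs' : 0 < s := by
      rcases hs.eq_or_lt with h | h
      · exact absurd (h ▸ ha0) (not_le.2 (hneg s ⟨le_rfl, hst⟩))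
      · exact h
    have ht' : 0 < t := hs'.trans_le hst
    rw [ha_pos s hs', ha_pos t ht', ← sub_nonneg, hinc s t hs' hst]
    refine setIntegral_nonneg measurableSet_Ioc fun τ hτ => ?_
    have hτ0 : 0 < τ := hs'.trans hτ.1
    have hτa := hneg τ ⟨hτ.1.le, hτ.2⟩
    rw [ha_pos τ hτ0] at hτa
    exact hflux τ hτ0 hτa.le
  -- conclusion
  intro t ht
  have h := NoReversal.nonneg_of_barrier ha_cont ha0 hmono t ht.le
  rw [ha_pos t ht] at h
  rw [hcomm (u t)]
  exact h

end Summit.AnomalousDissipation.AnomalousDissipation.Theorems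

end
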